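import Literature.Barriers.CriticalPhenomena.SAPColumnClasses
import HarnessLib

/-!
# Section lines, sections and section-minimal polygons (haruspicy, layer 6); Rechnitzer's
# Theorem 6, Lemma 10 and Theorem 12 as named facts

Companion of `SAPAnisotropicNotDFinite` / `SAPAnisotropicNotDFinite242Recurrence` (A. Rechnitzer,
*Haruspicy 2: The anisotropic generating function of self-avoiding polygons is not D-finite*,
J. Combin. Theory Ser. A 113 (2006) 520–546; numbering of arXiv:math/0406450v2). The tree proves
Theorem 1 (`Rechnitzer2006_thm1_holds`, module `SAPRowRational`) by the COARSE, whole-column form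
of haruspicy (layers 1–5: `SAPWords`, `SAPCanonical`, `SAPStretch`, `SAPSections`,
`SAPColumnClasses`): every polygon is a unique stretching of a column-minimal one. That form does
not see the denominator BOUNDS of §2 (Theorem 6, Theorem 12, Corollary 13): the column classes of
`𝒫_3` already carry spurious factors `1 - x²` which cancel only in the sum (the three
column-minimal C-shapes give `x³/((1-x)(1-x²)) · (1 + 2x/(1-x)) = x³/(1-x)³`), whereas
`D_3 = (1-x)⁵`. The bounds need the genuine notions of §2.1 — section lines, pages, sections,
duplicate sections, section-minimal polygons — which this file DEFINES on the word model of the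
previous layers (a polygon up to translation = a canonical word `w : List (Fin 4)`,
`Haruspicy.IsCanon`, by `polygonCount_eq_card_canonWords`), and over which it VENDORS, as named
facts stated as printed,

* **Theorem 6** (`Rechnitzer2006_thm6`, from Rechnitzer 2003): if `Ψ_k^α` divides the
  denominator of `H_n` then some section-minimal polygon of `𝒫_n` has `α` sections that are
  `K`-sections with `k ∣ K`;
* **Lemma 10**, second sentence (`Rechnitzer2006_lem10`): no polygon with fewer than `6k-4`
  vertical bonds contains a `k`-section;
* **Theorem 12** (`Rechnitzer2006_thm12`): a section-minimal polygon with `6k-4+2M` vertical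
  bonds has at most `2M+1` sections with `2k` or more horizontal bonds;

the three printed inputs ("This follows by combining the results of Theorems 1, 6 and 12") of
**Corollary 13** (`Rechnitzer2006_cor13` of `SAPAnisotropicNotDFinite242Recurrence`:
`D_n ∣ ∏_{k ≤ ⌈n/3⌉} Ψ_k^{2n-6k+5}`), whose assembly from them is the sibling
`SAPDenominatorBound`.

## The printed definitions (§2.1, arXiv p. 4; book version: A. Rechnitzer, in *Polygons,
## Polyominoes and Polycubes*, LNP 775 (2009), ch. 5, Definitions 3–6) and their counterparts

* Definition 2: "Draw horizontal lines from the extreme left and the extreme right of the lattice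
  towards the animal so that the lines run through the middle of each lattice cell. These lines
  are called section lines. The lines are terminated when they first touch (ie are obstructed
  by) a vertical bond. Cut the lattice along each section line from infinity until it terminates
  at a vertical bond. Then from this vertical bond cut vertically in both directions until
  another section line is reached. In this way the polygon (and the lattice) is split into pages
  … We call a section the set of horizontal bonds within a single column of a given page.
  Equivalently, it is the set of horizontal bonds of a column of an animal between two
  neighbouring section lines. A section with `2k` horizontal bonds is a `k`-section."
  Here: `rowCols w j` are the columns of the vertical bonds of row `[j, j+1]`; the section line
  of row `j` from the left (right) passes over the whole gap `[g, g+1]` iff row `j` has no vertical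
  bond in a column `≤ g` (`≥ g+1`): `CrossL w g j` (`CrossR w g j`), `Crosses = CrossL ∨ CrossR`.
  The cuts being horizontal section lines and vertical column lines, two horizontal bonds of one
  gap lie in one page iff no section line crosses the gap strictly between them (`Sep`); so a
  SECTION of the gap `g` is a maximal set of heights of horizontal bonds across `g`
  (`gapHeights w g`) pairwise not separated — the second, "equivalently", clause of the
  definition; we represent it by its least height `y` (`IsLeader w g y`), its height set is
  `secHeights w g y`, and `sections w` is the finite set of pairs `(g, y)`.
* Definition 3 (book Definition 5): "a section is a duplicate section if the section immediately
  on its left (without loss of generality) is identical and there are no vertical bonds between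
  them": `IsDup w g y` — `(g, y)` and `(g-1, y)` are sections with the same height set and the
  column `g` separating the two gaps carries no vertical bond in the rows spanned by the section.
* Definition 4: section-minimal polygons = no duplicate section: `IsSecMin w`;
  `smWords n` = the section-minimal canonical words with `2n` vertical bonds (finite: a
  section-minimal word is column-minimal, `IsSecMin.isColMin`, which is the content of the proof
  of Lemma 5 / book Lemma 5: "If there is no vertical bond between two columns, then the
  horizontal bond configuration in each column must be the same and so they will be duplicates
  of each other and so `A` is not minimal").

What is NOT here: pages as planar regions (only their trace on each gap, which is all that
sections need), section deletion/duplication as operations and the expansion generating function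
`G(P) = ∏_k (x^k/(1-x^k))^{σ_k(P)}` (Rechnitzer 2003; book Lemma 4) — the content of Theorem 6 —
and Lemmas 7–11 behind Theorem 12. These are the subjects of the discharges to come.

## References

* A. Rechnitzer, *Haruspicy 2*, J. Combin. Theory Ser. A 113 (2006) 520–546, §2 (Definitions 2–4,
  Lemma 5, Theorem 6, Lemmas 7–11, Theorem 12, Corollary 13). [Rechnitzer2006Haruspicy2]
* A. Rechnitzer, *Haruspicy and anisotropic generating functions*, Adv. Appl. Math. 30 (2003)
  228–257 (the source of Theorems 1 and 6; paywalled, not consulted).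
-/

noncomputable section

open Finset Literature.Probability.LatticeModels Literature.Probability.Percolation
open scoped BigOperators Polynomial

namespace Literature.Barriers.CriticalPhenomena

namespace Haruspicy

open Edwards2D

variable {w : List (Fin 4)}

/-! ### Vertical bonds by row, horizontal bonds by gap -/

/-- The row `[j, j+1]` occupied by the vertical letter `a` read at height `y`: `j = y` for `N`,
`j = y - 1` for `S` (junk `y` for horizontal letters). [folklore] -/
def rowOf (y : ℤ) (a : Fin 4) : ℤ := if a = 3 then y - 1 else y

/-- The row of an `N` read at height `y` is `[y, y+1]`. [folklore] -/
@[simp] theorem rowOf_N (y : ℤ) : rowOf y 2 = y := by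
  simp [rowOf]

/-- The row of an `S` read at height `y` is `[y-1, y]`. [folklore] -/
@[simp] theorem rowOf_S (y : ℤ) : rowOf y 3 = y - 1 := by
  simp [rowOf]

/-- `rowCols w j`: the columns `x` of the vertical bonds `{x} × [j, j+1]` of the word `w` (read
from the origin) — the vertical bonds of row `j`, which obstruct the section lines of that row.
[cite: Rechnitzer2006Haruspicy2, §2.1, Definition 2] -/
def rowCols (w : List (Fin 4)) (j : ℤ) : Finset ℤ :=
  ((Finset.range w.length).filter fun i =>
      2 ≤ (w.getD i 0).val ∧ rowOf (vtx w i 1) (w.getD i 0) = j).image fun i => vtx w i 0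

/-- Membership in `rowCols`. [folklore] -/
theorem mem_rowCols {j c : ℤ} :
    c ∈ rowCols w j ↔
      ∃ i < w.length, 2 ≤ (w.getD i 0).val ∧ rowOf (vtx w i 1) (w.getD i 0) = j ∧ vtx w i 0 = c := by
  simp [rowCols, and_assoc]

/-- The columns of the vertical bonds of any row are section columns. [folklore] -/
theorem rowCols_subset_secCols (j : ℤ) : rowCols w j ⊆ secCols w := by
  intro c hc
  obtain ⟨i, hi, hv, -, rfl⟩ := mem_rowCols.1 hc
  exact mem_secCols.2 ⟨i, hi, hv, rfl⟩

/-- `gapHeights w g`: the heights `y` of the horizontal bonds `[g, g+1] × {y}` of `w` — the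
horizontal bonds of the column across the gap `g`. [cite: Rechnitzer2006Haruspicy2, §2.1, Definition 2] -/
def gapHeights (w : List (Fin 4)) (g : ℤ) : Finset ℤ :=
  ((Finset.range w.length).filter fun i =>
      (w.getD i 0).val < 2 ∧ gapOf (vtx w i 0) (w.getD i 0) = g).image fun i => vtx w i 1

/-- Membership in `gapHeights`. [folklore] -/
theorem mem_gapHeights {g y : ℤ} :
    y ∈ gapHeights w g ↔
      ∃ i < w.length, (w.getD i 0).val < 2 ∧ gapOf (vtx w i 0) (w.getD i 0) = g ∧ vtx w i 1 = y := by
  simp [gapHeights, and_assoc]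

/-- A gap carries horizontal bonds iff it is one of the `gaps`. [folklore] -/
theorem gapHeights_nonempty_iff {g : ℤ} : (gapHeights w g).Nonempty ↔ g ∈ gaps w := by
  constructor
  · rintro ⟨y, hy⟩
    obtain ⟨i, hi, hh, hg, -⟩ := mem_gapHeights.1 hy
    exact mem_gaps.2 ⟨i, hi, hh, hg⟩
  · intro hg
    obtain ⟨i, hi, hh, hg⟩ := mem_gaps.1 hg
    exact ⟨vtx w i 1, mem_gapHeights.2 ⟨i, hi, hh, hg, rfl⟩⟩

/-! ### Section lines -/

/-- **The section line of row `j` from the left crosses the gap `g`**: the horizontal line at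
height `j + ½` drawn from `-∞` and "terminated when it first touches a vertical bond" passes over
the whole gap `[g, g+1]`, i.e. row `j` has no vertical bond in a column `≤ g` (rows without
vertical bonds are crossed entirely). [cite: Rechnitzer2006Haruspicy2, §2.1, Definition 2] -/
def CrossL (w : List (Fin 4)) (g j : ℤ) : Prop :=
  ∀ c ∈ rowCols w j, g + 1 ≤ c

/-- **The section line of row `j` from the right crosses the gap `g`**: row `j` has no vertical
bond in a column `≥ g + 1`. [cite: Rechnitzer2006Haruspicy2, §2.1, Definition 2] -/
def CrossR (w : List (Fin 4)) (g j : ℤ) : Prop :=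
  ∀ c ∈ rowCols w j, c ≤ g

/-- A section line (from either side) crosses the gap `g` at height `j + ½`.
[cite: Rechnitzer2006Haruspicy2, §2.1, Definition 2] -/
def Crosses (w : List (Fin 4)) (g j : ℤ) : Prop :=
  CrossL w g j ∨ CrossR w g j

/-- Rows without vertical bonds are crossed (from the left). [folklore] -/
theorem crossL_of_rowCols_eq_empty {g j : ℤ} (h : rowCols w j = ∅) : CrossL w g j := by
  intro c hc
  simp [h] at hc

/-! ### Sections -/

/-- Two heights `y < y'` of the gap `g` are **separated**: some section line crosses the gap
strictly between them, at a height `j + ½` with `y ≤ j < y'` (the two horizontal bonds lie in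
different pages). [cite: Rechnitzer2006Haruspicy2, §2.1, Definition 2] -/
def Sep (w : List (Fin 4)) (g y y' : ℤ) : Prop :=
  ∃ j, y ≤ j ∧ j < y' ∧ Crosses w g j

/-- Nothing separates a height from itself. [folklore] -/
theorem not_sep_self (w : List (Fin 4)) (g y : ℤ) : ¬ Sep w g y y := by
  rintro ⟨j, h1, h2, -⟩
  omega

/-- **`y` leads a section of the gap `g`**: `y` is the height of a horizontal bond across `g` and
is separated from every lower such height — it is the least height of its section ("the set of
horizontal bonds of a column … between two neighbouring section lines").
[cite: Rechnitzer2006Haruspicy2, §2.1, Definition 2] -/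
def IsLeader (w : List (Fin 4)) (g y : ℤ) : Prop :=
  y ∈ gapHeights w g ∧ ∀ y' ∈ gapHeights w g, y' < y → Sep w g y' y

open Classical in
/-- **The section of the gap `g` led by `y`**, as its set of heights: the heights `y' ≥ y` of
horizontal bonds across `g` not separated from `y` by a section line. Its cardinality is the
number of horizontal bonds of the section (`2K` for a `K`-section).
[cite: Rechnitzer2006Haruspicy2, §2.1, Definition 2] -/
def secHeights (w : List (Fin 4)) (g y : ℤ) : Finset ℤ :=
  (gapHeights w g).filter fun y' => y ≤ y' ∧ ¬ Sep w g y y'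

/-- Membership in `secHeights`. [folklore] -/
theorem mem_secHeights {g y y' : ℤ} :
    y' ∈ secHeights w g y ↔ y' ∈ gapHeights w g ∧ y ≤ y' ∧ ¬ Sep w g y y' := by
  classical
  simp [secHeights]

/-- A leader belongs to its own section. [folklore] -/
theorem IsLeader.mem_secHeights {g y : ℤ} (h : IsLeader w g y) : y ∈ secHeights w g y :=
  Haruspicy.mem_secHeights.2 ⟨h.1, le_rfl, not_sep_self w g y⟩

open Classical in
/-- **The sections of the word `w`**, as pairs `(g, y)` = (gap, least height); the number
`σ_K(P)` of `K`-sections of Definition 2 is the number of those with `#secHeights = 2K`.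
[cite: Rechnitzer2006Haruspicy2, §2.1, Definition 2] -/
def sections (w : List (Fin 4)) : Finset (ℤ × ℤ) :=
  (gaps w).biUnion fun g => ((gapHeights w g).filter fun y => IsLeader w g y).image fun y => (g, y)

/-- Membership in `sections`: the pair is a gap together with one of its leaders. [folklore] -/
theorem mem_sections {p : ℤ × ℤ} : p ∈ sections w ↔ IsLeader w p.1 p.2 := by
  classical
  constructor
  · intro h
    simp only [sections, Finset.mem_biUnion, Finset.mem_image, Finset.mem_filter] at h
    obtain ⟨g, -, y, ⟨-, hl⟩, rfl⟩ := h
    exact hl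
  · intro h
    simp only [sections, Finset.mem_biUnion, Finset.mem_image, Finset.mem_filter]
    exact ⟨p.1, gapHeights_nonempty_iff.1 ⟨p.2, h.1⟩, p.2, ⟨h.1, h⟩, rfl⟩

/-- Every section has at least one horizontal bond. [folklore] -/
theorem card_secHeights_pos {p : ℤ × ℤ} (h : p ∈ sections w) : 0 < (secHeights w p.1 p.2).card :=
  Finset.card_pos.2 ⟨p.2, IsLeader.mem_secHeights (mem_sections.1 h)⟩

/-- The least height of a non-empty gap leads a section. [folklore] -/
theorem isLeader_min' {g : ℤ} (h : (gapHeights w g).Nonempty) :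
    IsLeader w g ((gapHeights w g).min' h) :=
  ⟨Finset.min'_mem _ _, fun _ hy' hlt => absurd hlt (not_lt.2 (Finset.min'_le _ _ hy'))⟩

/-! ### Duplicate sections and section-minimal words -/

/-- **Duplicate section** (Definition 3; book Definition 5: "a section is a duplicate section if
the section immediately on its left is identical and there are no vertical bonds between
them"): `(g, y)` and `(g-1, y)` are sections of `w` with the same set of heights, and the column
`g` between the two gaps carries no vertical bond in a row `[j, j+1]` with `y ≤ j < y'` for some
height `y'` of the section (the rows spanned by the section).
[cite: Rechnitzer2006Haruspicy2, §2.1, Definition 3] -/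
def IsDup (w : List (Fin 4)) (g y : ℤ) : Prop :=
  IsLeader w g y ∧ IsLeader w (g - 1) y ∧ secHeights w (g - 1) y = secHeights w g y ∧
    ∀ j, y ≤ j → (∃ y' ∈ secHeights w g y, j < y') → g ∉ rowCols w j

/-- **Section-minimal** words (Definition 4: the polygons that cannot be reduced by deleting a
duplicate section): no section is a duplicate. [cite: Rechnitzer2006Haruspicy2, §2.1, Definition 4] -/
def IsSecMin (w : List (Fin 4)) : Prop :=
  ∀ g y, ¬ IsDup w g y

/-! ### Section-minimal words are column-minimal (the proof of Lemma 5) -/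

/-- The `x`-coordinate of the vertex after an `E`. [folklore] -/
theorem vtx_succ_zero_of_E {i : ℕ} (hi : i < w.length) (ha : w.getD i 0 = 0) :
    vtx w (i + 1) 0 = vtx w i 0 + 1 := by
  rw [vtx_succ w hi, ← List.getD_eq_getElem w 0 hi, ha, Pi.add_apply]
  simp

/-- The `x`-coordinate of the vertex after a `W`. [folklore] -/
theorem vtx_succ_zero_of_W {i : ℕ} (hi : i < w.length) (ha : w.getD i 0 = 1) :
    vtx w (i + 1) 0 = vtx w i 0 - 1 := by
  rw [vtx_succ w hi, ← List.getD_eq_getElem w 0 hi, ha, Pi.add_apply]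
  simp [sub_eq_add_neg]

/-- A horizontal letter keeps the height. [folklore] -/
theorem vtx_succ_one_of_lt {i : ℕ} (hi : i < w.length) (ha : (w.getD i 0).val < 2) :
    vtx w (i + 1) 1 = vtx w i 1 := by
  rw [vtx_succ w hi, ← List.getD_eq_getElem w 0 hi, Pi.add_apply, stepVec_apply_one_eq_zero ha,
    add_zero]

/-- A horizontal letter is `E` or `W`. [folklore] -/
theorem eq_zero_or_eq_one_of_lt {a : Fin 4} (ha : a.val < 2) : a = 0 ∨ a = 1 := by
  fin_cases a <;> simp at ha ⊢

/-- In a canonical word, a vertex in a column without vertical bonds is not one of the last two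
read: the closing vertex and the one before it lie in column `0`, a section column. [folklore] -/
theorem IsCanon.succ_lt_length (h : IsCanon w) {i : ℕ} (hi : i ≤ w.length)
    (hns : vtx w i 0 ∉ secCols w) : i + 1 < w.length := by
  have h0 := h.zero_mem_secCols
  by_contra hle
  rcases (show i = w.length ∨ i = w.length - 1 by omega) with rfl | rfl
  · rw [h.1.vtx_length_zero] at hns
    exact hns h0
  · rw [h.getD_length_sub_one.2] at hns
    exact hns h0

/-- **The two gaps around a column without vertical bonds carry the same horizontal bonds**: the
walk passes straight through such a column (`IsSAP.straight`). [folklore] -/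
theorem IsCanon.gapHeights_sub_one_eq (h : IsCanon w) {c : ℤ} (hc : c ∉ secCols w) :
    gapHeights w (c - 1) = gapHeights w c := by
  have hc0 : c ≠ 0 := fun h0 => hc (h0 ▸ h.zero_mem_secCols)
  -- a vertex read in column `c` has a predecessor, whose letter is repeated
  have hpred : ∀ {k : ℕ}, k < w.length → vtx w k 0 = c →
      ∃ j, k = j + 1 ∧ w.getD (j + 1) 0 = w.getD j 0 := by
    intro k hk hkc
    rcases Nat.eq_zero_or_pos k with rfl | _
    · exact absurd (by simpa using hkc.symm) hc0
    obtain ⟨j, rfl⟩ : ∃ j, k = j + 1 := ⟨k - 1, by omega⟩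
    exact ⟨j, rfl, (h.1.straight hk (by rwa [hkc])).1⟩
  -- a letter arriving in column `c` is repeated
  have hsucc : ∀ {k : ℕ}, k < w.length → vtx w (k + 1) 0 = c →
      k + 1 < w.length ∧ w.getD (k + 1) 0 = w.getD k 0 := by
    intro k hk hkc
    have hlt : k + 1 < w.length := by
      have := h.succ_lt_length (i := k + 1) hk (by rwa [hkc])
      omega
    exact ⟨hlt, (h.1.straight hlt (by rwa [hkc])).1⟩
  ext y
  rw [mem_gapHeights, mem_gapHeights]
  constructor
  · rintro ⟨k, hk, hhor, hgap, rfl⟩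
    rcases eq_zero_or_eq_one_of_lt hhor with hE | hW
    · -- an `E` from column `c-1` into column `c` is followed by an `E` across the gap `c`
      rw [hE, gapOf_E] at hgap
      have hk1 : vtx w (k + 1) 0 = c := by rw [vtx_succ_zero_of_E hk hE, hgap]; ring
      obtain ⟨hlt, heq⟩ := hsucc hk hk1
      exact ⟨k + 1, hlt, by rw [heq, hE]; decide, by rw [heq, hE, gapOf_E, hk1],
        vtx_succ_one_of_lt hk hhor⟩
    · -- a `W` read in column `c` (across the gap `c-1`) is preceded by a `W` across the gap `c`
      rw [hW, gapOf_W] at hgap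
      have hkc : vtx w k 0 = c := by omega
      obtain ⟨j, rfl, heq⟩ := hpred hk hkc
      have hj : j < w.length := by omega
      have hWj : w.getD j 0 = 1 := by rw [← heq, hW]
      have hx := vtx_succ_zero_of_W hj hWj
      exact ⟨j, hj, by rw [hWj]; decide, by rw [hWj, gapOf_W]; omega,
        (vtx_succ_one_of_lt hj (by rw [hWj]; decide)).symm⟩
  · rintro ⟨k, hk, hhor, hgap, rfl⟩
    rcases eq_zero_or_eq_one_of_lt hhor with hE | hW
    · -- an `E` read in column `c` is preceded by an `E` across the gap `c-1`
      rw [hE, gapOf_E] at hgap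
      obtain ⟨j, rfl, heq⟩ := hpred hk hgap
      have hj : j < w.length := by omega
      have hEj : w.getD j 0 = 0 := by rw [← heq, hE]
      have hx := vtx_succ_zero_of_E hj hEj
      exact ⟨j, hj, by rw [hEj]; decide, by rw [hEj, gapOf_E]; omega,
        (vtx_succ_one_of_lt hj (by rw [hEj]; decide)).symm⟩
    · -- a `W` across the gap `c` arrives in column `c` and is followed by a `W` across `c-1`
      rw [hW, gapOf_W] at hgap
      have hk1 : vtx w (k + 1) 0 = c := by rw [vtx_succ_zero_of_W hk hW]; omega
      obtain ⟨hlt, heq⟩ := hsucc hk hk1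
      exact ⟨k + 1, hlt, by rw [heq, hW]; decide, by rw [heq, hW, gapOf_W, hk1],
        vtx_succ_one_of_lt hk hhor⟩

/-- Around a column without vertical bonds the same section lines cross both gaps. [folklore] -/
theorem crosses_sub_one_iff {c : ℤ} (hc : c ∉ secCols w) (j : ℤ) :
    Crosses w (c - 1) j ↔ Crosses w c j := by
  have hcj : c ∉ rowCols w j := fun h => hc (rowCols_subset_secCols j h)
  have hne : ∀ c' ∈ rowCols w j, c' ≠ c := fun c' hc' h => hcj (h ▸ hc')
  unfold Crosses CrossL CrossR
  constructor
  · rintro (hL | hR)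
    · exact Or.inl fun c' hc' => by have := hL c' hc'; have := hne c' hc'; omega
    · exact Or.inr fun c' hc' => by have := hR c' hc'; omega
  · rintro (hL | hR)
    · exact Or.inl fun c' hc' => by have := hL c' hc'; omega
    · exact Or.inr fun c' hc' => by have := hR c' hc'; have := hne c' hc'; omega

/-- Separation depends only on the crossing section lines. [folklore] -/
theorem sep_congr {g g' : ℤ} (hC : ∀ j, Crosses w g j ↔ Crosses w g' j) (y y' : ℤ) :
    Sep w g y y' ↔ Sep w g' y y' := by
  simp only [Sep, hC]

/-- Leaders depend only on the heights of the gap and its crossing section lines. [folklore] -/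
theorem isLeader_congr {g g' : ℤ} (hH : gapHeights w g = gapHeights w g')
    (hC : ∀ j, Crosses w g j ↔ Crosses w g' j) (y : ℤ) : IsLeader w g y ↔ IsLeader w g' y := by
  simp only [IsLeader, hH, sep_congr hC]

/-- Sections depend only on the heights of the gap and its crossing section lines. [folklore] -/
theorem secHeights_congr {g g' : ℤ} (hH : gapHeights w g = gapHeights w g')
    (hC : ∀ j, Crosses w g j ↔ Crosses w g' j) (y : ℤ) : secHeights w g y = secHeights w g' y := by
  ext y'
  simp only [mem_secHeights, hH, sep_congr hC]

/-- **Section-minimal canonical words are column-minimal** (the proof of Lemma 5: "If there is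
no vertical bond between two columns, then the horizontal bond configuration in each column must
be the same and so they will be duplicates of each other and so `A` is not minimal"): if some
vertex lies in a column `c` without vertical bonds, the least section of the gap `c` duplicates
that of the gap `c-1`. [cite: Rechnitzer2006Haruspicy2, §2.1, Lemma 5] -/
theorem IsSecMin.isColMin (hm : IsSecMin w) (h : IsCanon w) : IsColMin w := by
  intro i hi
  by_contra hc
  have hH := h.gapHeights_sub_one_eq hc
  have hC := crosses_sub_one_iff (w := w) hc
  -- the letter read at `i` is horizontal, so the gap `c` (or `c-1`) carries a bond
  have hhor : (w.getD i 0).val < 2 := by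
    by_contra hv
    exact hc (mem_secCols.2 ⟨i, hi, not_lt.1 hv, rfl⟩)
  have hne : (gapHeights w (vtx w i 0)).Nonempty := by
    rcases eq_zero_or_eq_one_of_lt hhor with hE | hW
    · exact ⟨vtx w i 1, mem_gapHeights.2 ⟨i, hi, hhor, by rw [hE, gapOf_E], rfl⟩⟩
    · rw [← hH]
      exact ⟨vtx w i 1, mem_gapHeights.2 ⟨i, hi, hhor, by rw [hW, gapOf_W], rfl⟩⟩
  have hl := isLeader_min' hne
  exact hm (vtx w i 0) _ ⟨hl, (isLeader_congr hH hC _).2 hl, secHeights_congr hH hC _,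
    fun j _ _ hcj => hc (rowCols_subset_secCols j hcj)⟩

open Classical in
/-- **The section-minimal canonical words with `2n` vertical bonds**: the section-minimal
polygons of `𝒫_n` up to translation (finitely many, Lemma 5; filtered out of the column-minimal
words `colMinWords n`, which contain them by `IsSecMin.isColMin`).
[cite: Rechnitzer2006Haruspicy2, §2.1, Definition 4 and Lemma 5] -/
def smWords (n : ℕ) : Finset (List (Fin 4)) :=
  (colMinWords n).filter fun w => IsSecMin w

/-- Membership in `smWords`: canonical, section-minimal, `2n` vertical letters. [folklore] -/
theorem mem_smWords {n : ℕ} : w ∈ smWords n ↔ IsCanon w ∧ IsSecMin w ∧ vcount w = 2 * n := by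
  classical
  rw [smWords, Finset.mem_filter, mem_colMinWords]
  constructor
  · rintro ⟨⟨h1, -, h3⟩, h4⟩
    exact ⟨h1, h4, h3⟩
  · rintro ⟨h1, h2, h3⟩
    exact ⟨⟨h1, h2.isColMin h1, h3⟩, h2⟩


/-! ### A worked example: the C-shape

The polygon with cells `(0,0), (0,1), (0,2), (1,0), (1,2)` (a `3 × 2` rectangle with the middle
right cell removed), as the canonical word `E E N W N E N W W S S S`. The section line of row `1`
drawn from the right enters the notch and is stopped by the vertical bond in column `1`; it
crosses the gap `1` and cuts its four horizontal bonds (heights `0, 1, 2, 3`) into the two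
`1`-sections `{0, 1}` (lower arm) and `{2, 3}` (upper arm), which lie in different pages and can
indeed be stretched independently (arms of different lengths); no section line of rows `0, 1, 2`
crosses the spine gap `0`, whose two bonds (heights `0, 3`) form one `1`-section. So the C-shape
has the three sections `(0,0), (1,0), (1,2)`, pairwise distinct from their left neighbours: it is
section-minimal, and its expansion generating function is `(x/(1-x))³` — whereas at the level of
whole columns the gap `1` carries `k = 2` and the three column-minimal C-shapes are needed. -/

namespace CShape

/-- The C-shape `E E N W N E N W W S S S` (cells `(0,0),(0,1),(0,2),(1,0),(1,2)`), rooted at its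
least vertex. [folklore] -/
def cword : List (Fin 4) := [0, 0, 2, 1, 2, 0, 2, 1, 1, 3, 3, 3]

/-- The vertical bonds of the C-shape by row: columns `{0, 2}` in rows `0` and `2`, columns
`{0, 1}` in row `1` (the notch). [folklore] -/
theorem rowCols_spec {j c : ℤ} : c ∈ rowCols cword j ↔
    (j = 0 ∧ (c = 2 ∨ c = 0)) ∨ (j = 1 ∧ (c = 1 ∨ c = 0)) ∨ (j = 2 ∧ (c = 2 ∨ c = 0)) := by
  rw [mem_rowCols]
  constructor
  · rintro ⟨i, hi, hv, hr, rfl⟩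
    simp only [cword, List.length_cons, List.length_nil] at hi
    interval_cases i <;> simp [cword, vtx, rowOf] at hv hr ⊢ <;> omega
  · rintro (⟨rfl, rfl | rfl⟩ | ⟨rfl, rfl | rfl⟩ | ⟨rfl, rfl | rfl⟩)
    · exact ⟨2, by simp [cword], by simp [cword], by simp [cword, vtx, rowOf], by simp [cword, vtx]⟩
    · exact ⟨11, by simp [cword], by simp [cword], by simp [cword, vtx, rowOf], by simp [cword, vtx]⟩
    · exact ⟨4, by simp [cword], by simp [cword], by simp [cword, vtx, rowOf], by simp [cword, vtx]⟩
    · exact ⟨10, by simp [cword], by simp [cword], by simp [cword, vtx, rowOf], by simp [cword, vtx]⟩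
    · exact ⟨6, by simp [cword], by simp [cword], by simp [cword, vtx, rowOf], by simp [cword, vtx]⟩
    · exact ⟨9, by simp [cword], by simp [cword], by simp [cword, vtx, rowOf], by simp [cword, vtx]⟩

/-- The horizontal bonds of the C-shape by gap: heights `{0, 3}` across the spine gap `0`,
heights `{0, 1, 2, 3}` across the gap `1`. [folklore] -/
theorem gapHeights_spec {g y : ℤ} : y ∈ gapHeights cword g ↔
    (g = 0 ∧ (y = 0 ∨ y = 3)) ∨ (g = 1 ∧ (y = 0 ∨ y = 1 ∨ y = 2 ∨ y = 3)) := by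
  rw [mem_gapHeights]
  constructor
  · rintro ⟨i, hi, hv, hr, rfl⟩
    simp only [cword, List.length_cons, List.length_nil] at hi
    interval_cases i <;> simp [cword, vtx, gapOf] at hv hr ⊢ <;> omega
  · rintro (⟨rfl, rfl | rfl⟩ | ⟨rfl, rfl | rfl | rfl | rfl⟩)
    · exact ⟨0, by simp [cword], by simp [cword], by simp [cword, vtx, gapOf], by simp [cword, vtx]⟩
    · exact ⟨8, by simp [cword], by simp [cword], by simp [cword, vtx, gapOf], by simp [cword, vtx]⟩
    · exact ⟨1, by simp [cword], by simp [cword], by simp [cword, vtx, gapOf], by simp [cword, vtx]⟩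
    · exact ⟨3, by simp [cword], by simp [cword], by simp [cword, vtx, gapOf], by simp [cword, vtx]⟩
    · exact ⟨5, by simp [cword], by simp [cword], by simp [cword, vtx, gapOf], by simp [cword, vtx]⟩
    · exact ⟨7, by simp [cword], by simp [cword], by simp [cword, vtx, gapOf], by simp [cword, vtx]⟩

/-- Across the gap `1` exactly the section line of row `1` crosses (from the right, stopped by
the vertical bond of the notch in column `1`), besides those of the empty rows. [folklore] -/
theorem crosses_one_iff {j : ℤ} : Crosses cword 1 j ↔ j ≠ 0 ∧ j ≠ 2 := by
  constructor
  · rintro (hL | hR)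
    · constructor
      · rintro rfl; have := hL 0 (rowCols_spec.2 (Or.inl ⟨rfl, Or.inr rfl⟩)); omega
      · rintro rfl; have := hL 0 (rowCols_spec.2 (Or.inr (Or.inr ⟨rfl, Or.inr rfl⟩))); omega
    · constructor
      · rintro rfl; have := hR 2 (rowCols_spec.2 (Or.inl ⟨rfl, Or.inl rfl⟩)); omega
      · rintro rfl; have := hR 2 (rowCols_spec.2 (Or.inr (Or.inr ⟨rfl, Or.inl rfl⟩))); omega
  · rintro ⟨h0, h2⟩
    by_cases h1 : j = 1
    · subst h1
      exact Or.inr fun c hc => by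
        rcases rowCols_spec.1 hc with ⟨h, _⟩ | ⟨_, rfl | rfl⟩ | ⟨h, _⟩ <;> omega
    · exact Or.inl fun c hc => by
        rcases rowCols_spec.1 hc with ⟨h, _⟩ | ⟨h, _⟩ | ⟨h, _⟩ <;> omega

/-- Across the spine gap `0` no section line of the rows `0, 1, 2` crosses. [folklore] -/
theorem crosses_zero_iff {j : ℤ} : Crosses cword 0 j ↔ j ≠ 0 ∧ j ≠ 1 ∧ j ≠ 2 := by
  constructor
  · rintro (hL | hR)
    · refine ⟨?_, ?_, ?_⟩ <;> rintro rfl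
      · have := hL 0 (rowCols_spec.2 (Or.inl ⟨rfl, Or.inr rfl⟩)); omega
      · have := hL 0 (rowCols_spec.2 (Or.inr (Or.inl ⟨rfl, Or.inr rfl⟩))); omega
      · have := hL 0 (rowCols_spec.2 (Or.inr (Or.inr ⟨rfl, Or.inr rfl⟩))); omega
    · refine ⟨?_, ?_, ?_⟩ <;> rintro rfl
      · have := hR 2 (rowCols_spec.2 (Or.inl ⟨rfl, Or.inl rfl⟩)); omega
      · have := hR 1 (rowCols_spec.2 (Or.inr (Or.inl ⟨rfl, Or.inl rfl⟩))); omega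
      · have := hR 2 (rowCols_spec.2 (Or.inr (Or.inr ⟨rfl, Or.inl rfl⟩))); omega
  · rintro ⟨h0, h1, h2⟩
    exact Or.inl fun c hc => by
      rcases rowCols_spec.1 hc with ⟨h, _⟩ | ⟨h, _⟩ | ⟨h, _⟩ <;> omega

/-- The leaders of the sections of the C-shape: `(0,0)`, `(1,0)`, `(1,2)`. [folklore] -/
theorem isLeader_iff {g y : ℤ} :
    IsLeader cword g y ↔ (g = 0 ∧ y = 0) ∨ (g = 1 ∧ y = 0) ∨ (g = 1 ∧ y = 2) := by
  constructor
  · rintro ⟨hy, hsep⟩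
    rcases gapHeights_spec.1 hy with ⟨rfl, rfl | rfl⟩ | ⟨rfl, rfl | rfl | rfl | rfl⟩
    · exact Or.inl ⟨rfl, rfl⟩
    · exfalso
      obtain ⟨j, h1, h2, h3⟩ := hsep 0 (gapHeights_spec.2 (Or.inl ⟨rfl, Or.inl rfl⟩)) (by norm_num)
      rw [crosses_zero_iff] at h3; omega
    · exact Or.inr (Or.inl ⟨rfl, rfl⟩)
    · exfalso
      obtain ⟨j, h1, h2, h3⟩ := hsep 0 (gapHeights_spec.2 (Or.inr ⟨rfl, Or.inl rfl⟩)) (by norm_num)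
      rw [crosses_one_iff] at h3; omega
    · exact Or.inr (Or.inr ⟨rfl, rfl⟩)
    · exfalso
      obtain ⟨j, h1, h2, h3⟩ :=
        hsep 2 (gapHeights_spec.2 (Or.inr ⟨rfl, Or.inr (Or.inr (Or.inl rfl))⟩)) (by norm_num)
      rw [crosses_one_iff] at h3; omega
  · rintro (⟨rfl, rfl⟩ | ⟨rfl, rfl⟩ | ⟨rfl, rfl⟩)
    · exact ⟨gapHeights_spec.2 (Or.inl ⟨rfl, Or.inl rfl⟩), fun y' hy' hlt => by
        rcases gapHeights_spec.1 hy' with ⟨-, rfl | rfl⟩ | ⟨h, -⟩ <;> omega⟩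
    · exact ⟨gapHeights_spec.2 (Or.inr ⟨rfl, Or.inl rfl⟩), fun y' hy' hlt => by
        rcases gapHeights_spec.1 hy' with ⟨h, -⟩ | ⟨-, rfl | rfl | rfl | rfl⟩ <;> omega⟩
    · refine ⟨gapHeights_spec.2 (Or.inr ⟨rfl, Or.inr (Or.inr (Or.inl rfl))⟩), fun y' hy' hlt => ?_⟩
      rcases gapHeights_spec.1 hy' with ⟨h, -⟩ | ⟨-, rfl | rfl | rfl | rfl⟩
      · omega
      · exact ⟨1, by norm_num, by norm_num, crosses_one_iff.2 ⟨by norm_num, by norm_num⟩⟩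
      · exact ⟨1, le_rfl, by norm_num, crosses_one_iff.2 ⟨by norm_num, by norm_num⟩⟩
      · omega
      · omega

/-- **The sections of the C-shape** are `(0,0)`, `(1,0)` and `(1,2)`. [folklore] -/
theorem sections_eq : sections cword = {((0 : ℤ), (0 : ℤ)), (1, 0), (1, 2)} := by
  ext p
  rw [mem_sections, isLeader_iff]
  simp only [Finset.mem_insert, Finset.mem_singleton, Prod.ext_iff]

/-- The lower arm: the section of the gap `1` led by `0` is the `1`-section `{0, 1}`. [folklore] -/
theorem secHeights_one_zero : secHeights cword 1 0 = {0, 1} := by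
  ext y
  rw [mem_secHeights, gapHeights_spec]
  simp only [Finset.mem_insert, Finset.mem_singleton, Sep, crosses_one_iff]
  constructor
  · rintro ⟨⟨h, -⟩ | ⟨-, rfl | rfl | rfl | rfl⟩, h0, hs⟩
    · omega
    · exact Or.inl rfl
    · exact Or.inr rfl
    · exact absurd ⟨1, by norm_num, by norm_num, by norm_num, by norm_num⟩ hs
    · exact absurd ⟨1, by norm_num, by norm_num, by norm_num, by norm_num⟩ hs
  · rintro (rfl | rfl)
    · exact ⟨Or.inr ⟨trivial, Or.inl rfl⟩, le_rfl, by rintro ⟨j, h1, h2, h3, h4⟩; omega⟩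
    · exact ⟨Or.inr ⟨trivial, Or.inr (Or.inl rfl)⟩, by norm_num, by rintro ⟨j, h1, h2, h3, h4⟩; omega⟩

/-- The spine: the section of the gap `0` led by `0` is the `1`-section `{0, 3}`. [folklore] -/
theorem secHeights_zero_zero : secHeights cword 0 0 = {0, 3} := by
  ext y
  rw [mem_secHeights, gapHeights_spec]
  simp only [Finset.mem_insert, Finset.mem_singleton, Sep, crosses_zero_iff]
  constructor
  · rintro ⟨⟨-, rfl | rfl⟩ | ⟨h, -⟩, h0, hs⟩
    · exact Or.inl rfl
    · exact Or.inr rfl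
    · omega
  · rintro (rfl | rfl)
    · exact ⟨Or.inl ⟨trivial, Or.inl rfl⟩, le_rfl, by rintro ⟨j, h1, h2, h3, h4, h5⟩; omega⟩
    · exact ⟨Or.inl ⟨trivial, Or.inr rfl⟩, by norm_num, by rintro ⟨j, h1, h2, h3, h4, h5⟩; omega⟩

/-- **The C-shape is section-minimal**: no section equals its left neighbour. [folklore] -/
theorem isSecMin : IsSecMin cword := by
  rintro g y ⟨h1, h2, h3, -⟩
  rcases isLeader_iff.1 h1 with ⟨rfl, rfl⟩ | ⟨rfl, rfl⟩ | ⟨rfl, rfl⟩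
  · rcases isLeader_iff.1 h2 with ⟨h, -⟩ | ⟨h, -⟩ | ⟨h, -⟩ <;> omega
  · -- the sections `{0,3}` of the gap `0` and `{0,1}` of the gap `1` differ
    have h3' : (3 : ℤ) ∈ secHeights cword 1 0 := by
      rw [← h3, show (1 : ℤ) - 1 = 0 by norm_num, secHeights_zero_zero]; simp
    rw [secHeights_one_zero] at h3'
    simp at h3'
  · rcases isLeader_iff.1 h2 with ⟨-, h⟩ | ⟨h, -⟩ | ⟨h, -⟩ <;> omega

end CShape

end Haruspicy

/-! ### The printed inputs of Corollary 13, as named facts -/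

open Haruspicy

/-- **Rechnitzer 2006, Theorem 6** (from Rechnitzer 2003): "If `H_n(x)` has a denominator factor
`Ψ_k(x)`, then `𝒫_n` must contain a section-minimal polygon containing a `K`-section for some
`K ∈ ℤ⁺` divisible by `k`. Further if `H_n(x)` has a denominator factor `Ψ_k(x)^α`, then `𝒫_n`
must contain a section-minimal polygon that contains `α` sections that are `K`-sections for
some (possibly different) `K ∈ ℤ⁺` divisible by `k`." Formal reading: for `n, k, α ≥ 1`, if in
lowest terms `H_n = N/D` (`N`, `D` coprime in `ℚ[x]`, `D · H_n = N` in `ℚ⟦x⟧`) and `Ψ_k^α ∣ D`,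
then some section-minimal canonical word `w` with `2n` vertical bonds (`Haruspicy.smWords n`;
the polygons of `𝒫_n` up to translation are the canonical words,
`polygonCount_eq_card_canonWords`) has at least `α` sections whose number of horizontal bonds is
divisible by `2k` (a `K`-section has `2K` of them). Printed proof (Rechnitzer 2003; book
Lemma 4, Theorem 4): `H_n = Σ_{P section-minimal} ∏_K (x^K/(1-x^K))^{σ_K(P)}`.
[cite: Rechnitzer2006Haruspicy2, Theorem 6] -/
def Rechnitzer2006_thm6 : Prop :=
  ∀ n k α : ℕ, 1 ≤ n → 1 ≤ k → 1 ≤ α →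
    ∀ N D : ℚ[X], IsCoprime N D → (D : PowerSeries ℚ) * sapRowGF ℚ n = N →
      Polynomial.cyclotomic k ℚ ^ α ∣ D →
        ∃ w ∈ smWords n,
          α ≤ ((sections w).filter fun s => 2 * k ∣ (secHeights w s.1 s.2).card).card

/-- **Rechnitzer 2006, Lemma 10**: "To the left (without loss of generality) of a `k`-section
there are at least `3k-2` vertical bonds, of which at least `2k-1` obstruct section lines. Hence
no polygon with fewer than `6k-4` vertical bonds may contain a `k`-section. Further, it is
always possible to construct a polygon with `6k-4` vertical bonds and a single `k`-section."
Vendored: the second sentence (the consequence by which Corollary 13 stops its product at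
`⌈n/3⌉`): a canonical word having a section with exactly `2k` horizontal bonds, `k ≥ 1`, has at
least `6k-4` vertical letters. [cite: Rechnitzer2006Haruspicy2, Lemma 10] -/
def Rechnitzer2006_lem10 : Prop :=
  ∀ w : List (Fin 4), IsCanon w → ∀ k : ℕ, 1 ≤ k →
    (∃ s ∈ sections w, (secHeights w s.1 s.2).card = 2 * k) → 6 * k - 4 ≤ vcount w

/-- **Rechnitzer 2006, Theorem 12**: "A section-minimal polygon `P` that contains
`2V = (6k-4+2M)` vertical bonds may not contain more than `2M+1` sections that contain `2k` or
more horizontal bonds." (Printed proof: Lemmas 7–9 — a section-minimal polygon with `2V` vertical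
bonds has at most `2V-1` sections — and the stretching Lemma 11, by which at least `3(k-1)`
sections lie beyond each outermost such section.) [cite: Rechnitzer2006Haruspicy2, Theorem 12] -/
def Rechnitzer2006_thm12 : Prop :=
  ∀ w : List (Fin 4), IsCanon w → IsSecMin w → ∀ k M : ℕ, 1 ≤ k →
    vcount w = 6 * k - 4 + 2 * M →
      ((sections w).filter fun s => 2 * k ≤ (secHeights w s.1 s.2).card).card ≤ 2 * M + 1

end Literature.Barriers.CriticalPhenomena
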